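import Mathlib

/-!
# Line `Sketch` (separable-majorant) for crux `FidelityWitnesses.FidelityThesis` (stmt-MatrixMultiplication-4956) —
stub `stub_gramSchurBound`: the GRAM–SCHUR BOUND (pure finite-dimensional linear algebra)

For a finite family of vectors `x_k ∈ ℂ^β` (`k ∈ α`) and a vector `χ ∈ ℂ^β`, put `c_k := Σ_b χ_b x_k(b)`
(bilinear pairing, no conjugate on `χ`) and let `G_{kk'} := Σ_b conj(x_k(b)) x_{k'}(b)` be the Gram matrix.
Then `Σ_k |c_k|² ≤ ‖G‖_F · ‖χ‖²`, where `‖G‖_F = sqrt(Σ_{k,k'} |G_{kk'}|²)` is the Frobenius norm.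
(Equivalently: `‖X χ‖² ≤ ‖X‖_op² ‖χ‖²` and `‖X‖_op² = ‖X X^*‖_op ≤ ‖X X^*‖_F`; the line uses it to bound the
injective norm of the explicit "chirp" tensors.)

Proof (elementary, no operator norms).  With `T := Σ_k |c_k|²` and `y_b := Σ_k conj(c_k) x_k(b)`:
`T = Σ_k conj(c_k) c_k = Σ_b χ_b y_b`, so `T ≤ ‖χ‖ ‖y‖` (Cauchy–Schwarz), i.e. `T² ≤ ‖χ‖² ‖y‖²`; and
`‖y‖² = Σ_b conj(y_b) y_b = Σ_{k,k'} c_k conj(c_{k'}) G_{kk'}`, whose modulus is at most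
`Σ_{k,k'} |c_k| |c_{k'}| |G_{kk'}| ≤ sqrt(Σ_{k,k'} |c_k|²|c_{k'}|²) · ‖G‖_F = T ‖G‖_F` (Cauchy–Schwarz on `α × α`).
Hence `T² ≤ ‖χ‖² · T · ‖G‖_F`; if `T = 0` the claim is trivial, else divide by `T`.
Supports item `stmt-MatrixMultiplication-4956`; no definitions; Mathlib only.
-/

namespace Summit.MatrixMultiplication.MatrixMultiplication.Theorems

open scoped BigOperators ComplexConjugate

/-- `Σ_k |c_k|² = Σ_b χ_b y_b` with `y_b = Σ_k conj(c_k) x_k(b)`, when `c_k = Σ_b χ_b x_k(b)`: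
expand `|c_k|² = conj(c_k) c_k`, substitute the second factor and swap the sums. [folklore] -/
theorem gramSchur_sqnorm_sum_eq {α β : Type*} [Fintype α] [Fintype β] (x : α → β → ℂ) (χ : β → ℂ)
    (c : α → ℂ) (hc : ∀ k, c k = ∑ b, χ b * x k b) :
    ((∑ k, ‖c k‖ ^ 2 : ℝ) : ℂ) = ∑ b, χ b * ∑ k, conj (c k) * x k b :=
  calc ((∑ k, ‖c k‖ ^ 2 : ℝ) : ℂ) = ∑ k, conj (c k) * c k := by
        rw [Complex.ofReal_sum]
        exact Finset.sum_congr rfl fun k _ => by rw [Complex.ofReal_pow, Complex.conj_mul']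
    _ = ∑ k, conj (c k) * ∑ b, χ b * x k b := Finset.sum_congr rfl fun k _ => by rw [← hc k]
    _ = ∑ k, ∑ b, χ b * (conj (c k) * x k b) := by
        refine Finset.sum_congr rfl fun k _ => ?_
        rw [Finset.mul_sum]
        exact Finset.sum_congr rfl fun b _ => by ring
    _ = ∑ b, ∑ k, χ b * (conj (c k) * x k b) := Finset.sum_comm
    _ = ∑ b, χ b * ∑ k, conj (c k) * x k b :=
        Finset.sum_congr rfl fun b _ => (Finset.mul_sum _ _ _).symm

/-- `‖y‖² = Σ_{k,k'} c_k conj(c_{k'}) G_{kk'}` for `y_b = Σ_k conj(c_k) x_k(b)` and the Gram matrix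
`G_{kk'} = Σ_b conj(x_k(b)) x_{k'}(b)`: expand `|y_b|² = conj(y_b) y_b` and swap the sums.
[folklore] -/
theorem gramSchur_sqnorm_y_eq {α β : Type*} [Fintype α] [Fintype β] (x : α → β → ℂ) (c : α → ℂ)
    (y : β → ℂ) (hy : ∀ b, y b = ∑ k, conj (c k) * x k b) :
    ((∑ b, ‖y b‖ ^ 2 : ℝ) : ℂ) = ∑ k, ∑ k', c k * conj (c k') * ∑ b, conj (x k b) * x k' b :=
  calc ((∑ b, ‖y b‖ ^ 2 : ℝ) : ℂ) = ∑ b, conj (y b) * y b := by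
        rw [Complex.ofReal_sum]
        exact Finset.sum_congr rfl fun b _ => by rw [Complex.ofReal_pow, Complex.conj_mul']
    _ = ∑ b, ∑ k, ∑ k', c k * conj (c k') * (conj (x k b) * x k' b) := by
        refine Finset.sum_congr rfl fun b _ => ?_
        rw [hy b, map_sum, Finset.sum_mul]
        refine Finset.sum_congr rfl fun k _ => ?_
        rw [Finset.mul_sum]
        refine Finset.sum_congr rfl fun k' _ => ?_
        rw [map_mul, Complex.conj_conj]
        ring
    _ = ∑ k, ∑ b, ∑ k', c k * conj (c k') * (conj (x k b) * x k' b) := Finset.sum_comm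
    _ = ∑ k, ∑ k', ∑ b, c k * conj (c k') * (conj (x k b) * x k' b) :=
        Finset.sum_congr rfl fun k _ => Finset.sum_comm
    _ = ∑ k, ∑ k', c k * conj (c k') * ∑ b, conj (x k b) * x k' b :=
        Finset.sum_congr rfl fun k _ => Finset.sum_congr rfl fun k' _ => (Finset.mul_sum _ _ _).symm

/-- Cauchy–Schwarz on `α × α`:
`|Σ_{k,k'} c_k conj(c_{k'}) G_{kk'}| ≤ (Σ_k |c_k|²) · sqrt(Σ_{k,k'} |G_{kk'}|²)`, since
`Σ_{k,k'} (|c_k| |c_{k'}|)² = (Σ_k |c_k|²)²` (`Real.sum_mul_le_sqrt_mul_sqrt` on `univ ×ˢ univ`). [folklore] -/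
theorem gramSchur_double_cs {α : Type*} [Fintype α] (c : α → ℂ) (G : α → α → ℂ) :
    ‖∑ k, ∑ k', c k * conj (c k') * G k k'‖ ≤
      (∑ k, ‖c k‖ ^ 2) * Real.sqrt (∑ k, ∑ k', ‖G k k'‖ ^ 2) := by
  have h1 : ‖∑ k, ∑ k', c k * conj (c k') * G k k'‖ ≤ ∑ k, ∑ k', ‖c k‖ * ‖c k'‖ * ‖G k k'‖ := by
    refine (norm_sum_le _ _).trans (Finset.sum_le_sum fun k _ => (norm_sum_le _ _).trans ?_)
    refine Finset.sum_le_sum fun k' _ => ?_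
    rw [norm_mul, norm_mul, Complex.norm_conj]
  have h2 : ∑ k, ∑ k', ‖c k‖ * ‖c k'‖ * ‖G k k'‖ ≤
      Real.sqrt (∑ k, ∑ k', (‖c k‖ * ‖c k'‖) ^ 2) * Real.sqrt (∑ k, ∑ k', ‖G k k'‖ ^ 2) := by
    have := Real.sum_mul_le_sqrt_mul_sqrt (Finset.univ ×ˢ Finset.univ)
      (fun p : α × α => ‖c p.1‖ * ‖c p.2‖) (fun p => ‖G p.1 p.2‖)
    simpa only [Finset.sum_product] using this
  have h3 : ∑ k, ∑ k', (‖c k‖ * ‖c k'‖) ^ 2 = (∑ k, ‖c k‖ ^ 2) ^ 2 := by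
    rw [sq (∑ k, ‖c k‖ ^ 2), Finset.sum_mul_sum]
    exact Finset.sum_congr rfl fun k _ => Finset.sum_congr rfl fun k' _ => mul_pow _ _ 2
  rw [h3, Real.sqrt_sq (Finset.sum_nonneg fun k _ => sq_nonneg _)] at h2
  exact h1.trans h2

/-- The final real-arithmetic step: `T ≤ sqrt N · sqrt Y` and `Y ≤ T · F` (all nonnegative) give
`T² ≤ N · T · F`, hence `T ≤ F · N` (trivial if `T = 0`, else cancel `T`). [folklore] -/
theorem gramSchur_combine {T N Y F : ℝ} (hT : 0 ≤ T) (hN : 0 ≤ N) (hY : 0 ≤ Y) (hF : 0 ≤ F)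
    (hA : T ≤ Real.sqrt N * Real.sqrt Y) (hB : Y ≤ T * F) : T ≤ F * N := by
  have hsq : T ^ 2 ≤ N * (T * F) :=
    calc T ^ 2 ≤ (Real.sqrt N * Real.sqrt Y) ^ 2 := pow_le_pow_left₀ hT hA 2
      _ = N * Y := by rw [mul_pow, Real.sq_sqrt hN, Real.sq_sqrt hY]
      _ ≤ N * (T * F) := mul_le_mul_of_nonneg_left hB hN
  rcases hT.eq_or_lt with h0 | hpos
  · rw [← h0]; exact mul_nonneg hF hN
  · refine le_of_mul_le_mul_left ?_ hpos
    calc T * T = T ^ 2 := (sq T).symm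
      _ ≤ N * (T * F) := hsq
      _ = T * (F * N) := by ring

/-- **Gram–Schur bound.** For a finite family of vectors `x_k ∈ ℂ^β` and `χ ∈ ℂ^β`, with
`c_k := Σ_b χ_b x_k(b)` (bilinear pairing) and Gram matrix `G_{kk'} := Σ_b conj(x_k(b)) x_{k'}(b)`:
`Σ_k |c_k|² ≤ ‖G‖_F · ‖χ‖²`, `‖G‖_F = sqrt(Σ_{k,k'} |G_{kk'}|²)`.  Proof: `T := Σ_k |c_k|² = Σ_b χ_b y_b`
with `y_b := Σ_k conj(c_k) x_k(b)` (`gramSchur_sqnorm_sum_eq`), so `T ≤ ‖χ‖ ‖y‖` (`norm_sum_le` and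
`Real.sum_mul_le_sqrt_mul_sqrt`); and
`‖y‖² = Σ_{k,k'} c_k conj(c_{k'}) G_{kk'}` (`gramSchur_sqnorm_y_eq`) has modulus `≤ T ‖G‖_F`
(`gramSchur_double_cs`); conclude by `gramSchur_combine`. [folklore] -/
theorem stub_gramSchurBound {α β : Type*} [Fintype α] [Fintype β] (x : α → β → ℂ) (χ : β → ℂ) :
    ∑ k, ‖∑ b, χ b * x k b‖ ^ 2 ≤
      Real.sqrt (∑ k, ∑ k', ‖∑ b, conj (x k b) * x k' b‖ ^ 2) * ∑ b, ‖χ b‖ ^ 2 := by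
  obtain ⟨c, hc⟩ : ∃ c : α → ℂ, ∀ k, ∑ b, χ b * x k b = c k := ⟨_, fun _ => rfl⟩
  obtain ⟨G, hG⟩ : ∃ G : α → α → ℂ, ∀ k k', ∑ b, conj (x k b) * x k' b = G k k' :=
    ⟨_, fun _ _ => rfl⟩
  obtain ⟨y, hy⟩ : ∃ y : β → ℂ, ∀ b, ∑ k, conj (c k) * x k b = y b := ⟨_, fun _ => rfl⟩
  simp only [hc, hG]
  have hT0 : 0 ≤ ∑ k, ‖c k‖ ^ 2 := Finset.sum_nonneg fun k _ => sq_nonneg _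
  have hY0 : 0 ≤ ∑ b, ‖y b‖ ^ 2 := Finset.sum_nonneg fun b _ => sq_nonneg _
  have hA : ∑ k, ‖c k‖ ^ 2 ≤ Real.sqrt (∑ b, ‖χ b‖ ^ 2) * Real.sqrt (∑ b, ‖y b‖ ^ 2) := by
    have h := gramSchur_sqnorm_sum_eq x χ c fun k => (hc k).symm
    simp only [hy] at h
    have := calc ‖∑ b, χ b * y b‖ ≤ ∑ b, ‖χ b * y b‖ := norm_sum_le _ _
      _ = ∑ b, ‖χ b‖ * ‖y b‖ := Finset.sum_congr rfl fun _ _ => norm_mul _ _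
      _ ≤ Real.sqrt (∑ b, ‖χ b‖ ^ 2) * Real.sqrt (∑ b, ‖y b‖ ^ 2) :=
        Real.sum_mul_le_sqrt_mul_sqrt _ _ _
    rw [← h, Complex.norm_real, Real.norm_of_nonneg hT0] at this
    exact this
  have hB : ∑ b, ‖y b‖ ^ 2 ≤ (∑ k, ‖c k‖ ^ 2) * Real.sqrt (∑ k, ∑ k', ‖G k k'‖ ^ 2) := by
    have h := gramSchur_sqnorm_y_eq x c y fun b => (hy b).symm
    simp only [hG] at h
    have := gramSchur_double_cs c G
    rw [← h, Complex.norm_real, Real.norm_of_nonneg hY0] at this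
    exact this
  exact gramSchur_combine hT0 (Finset.sum_nonneg fun b _ => sq_nonneg _) hY0 (Real.sqrt_nonneg _)
    hA hB

end Summit.MatrixMultiplication.MatrixMultiplication.Theorems
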